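import Literature.NumberTheory.GaloisRepresentations.CyclicNormIndex
import HarnessLib

/-!
# Crossed homomorphisms into a commutative group with an action by endomorphisms: the cyclic
# criterion `H¹ = 0 ⟸ Ĥ⁻¹ = 0` and the inflation–restriction criterion `H¹(N) = 0, H¹(G/N) = 0 ⟹ H¹(G) = 0`,
# in element form (Serre, *Local Fields* VII §6 Prop. 4, VIII §4; Neukirch, *Bonn Lectures* I (6.1))

Topic `Algebra/Homology`; namespace `Literature.Algebra.Homology.CrossedHomElem`.  Proof file: theorems
only (no definition, no named fact, no instance).

Setting: a group `Γ` acting on a commutative group `G` through a family of endomorphisms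
`act : Γ → (G →* G)` with `act (g h) = act g ∘ act h` and `act 1 = id` (no `MulAction` instance is
assumed, so that the lemmas apply to actions given as bare families of homomorphisms, e.g. the Galois
action `classGalAct` on idele class groups).  A crossed homomorphism is `f : Γ → G` with
`f (g h) = act g (f h) · f g` (Mathlib's `groupCohomology.IsMulCocycle₁` convention), a coboundary is
`g ↦ act g c / c` (`IsMulCoboundary₁`).  Everything is elementary group algebra:

* §1 `f 1 = 1`; coboundaries and pointwise products of crossed homomorphisms are crossed
  homomorphisms; twisting / untwisting by a coboundary; `f (σ^i) = ∏_{j<i} σ^j • f σ`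
  (Neukirch I (6.1): "`x(σᵏ) = Σ_{i=0}^{k-1} σⁱ x(σ)`") and the telescoping of a coboundary on powers.
* §2 **`exists_coboundary_of_isCyclic_of_normKer`** — for `Γ = ⟨σ⟩` finite cyclic: if every `c ∈ G`
  with `∏_{g ∈ Γ} g • c = 1` is of the form `σ • d / d` (i.e. `Ĥ⁻¹(Γ, G) = 0`), then every crossed
  homomorphism is a coboundary (`H¹(Γ, G) = 0`) — the half `x ↦ x(σ)` of Neukirch I (6.1)
  `H¹ ≅ _N A / I_G A`.
* §3 **`exists_coboundary_of_inflation_restriction`** — Serre VII §6 Prop. 4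
  (`0 → H¹(Γ/N, G^N) → H¹(Γ, G) → H¹(N, G)` exact) used as a vanishing criterion, with the quotient
  given abstractly: homomorphisms `r : N →* Γ`, `q : Γ →* Q` with `q ∘ r = 1`, `q` surjective and
  `ker q ⊆ range r`; a commutative group `G'` with `Q`-action `act'` and an injective equivariant
  `ι : G' →* G` (`act g (ι a) = ι (act' (q g) a)`) onto which every `r(N)`-fixed element of `G`
  descends (`G^N = ι(G')`).  If crossed homomorphisms `N → G` (for `act ∘ r`) and `Q → G'` are
  coboundaries, so is every crossed homomorphism `Γ → G`.

## References

* J.-P. Serre, *Local Fields*, GTM 67 (1979), Ch. VII §6 Prop. 4 (inflation–restriction in degree 1),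
  Ch. VIII §4 (cohomology of finite cyclic groups). [SerreLocalFields1979]
* J. Neukirch, *Class Field Theory — The Bonn Lectures* (2013), Part I §6 Thm. (6.1). [Neukirch2013]
-/

namespace Literature.Algebra.Homology.CrossedHomElem

open Finset

/-! ## §1. Crossed homomorphisms for an action by endomorphisms -/

section Basic

variable {Γ G : Type*} [Group Γ] [CommGroup G] (act : Γ → G →* G)

/-- A crossed homomorphism has `f 1 = 1` (given `act 1 = id`).
[cite: SerreLocalFields1979, Ch. VII §3 (1-cocycles)] -/
theorem map_one_of_crossed (hone : ∀ x, act 1 x = x) {f : Γ → G}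
    (hf : ∀ g h, f (g * h) = act g (f h) * f g) : f 1 = 1 := by
  have h := hf 1 1
  rw [mul_one, hone] at h
  calc f 1 = f 1 * f 1 * (f 1)⁻¹ := by rw [mul_inv_cancel_right]
    _ = f 1 * (f 1)⁻¹ := by rw [← h]
    _ = 1 := mul_inv_cancel _

/-- The coboundary `g ↦ act g c / c` of `c` is a crossed homomorphism.
[cite: SerreLocalFields1979, Ch. VII §3 (1-cocycles)] -/
theorem coboundary_crossed (hmul : ∀ g h x, act (g * h) x = act g (act h x)) (c : G) (g h : Γ) :
    act (g * h) c / c = act g (act h c / c) * (act g c / c) := by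
  rw [map_div, ← hmul, div_mul_div_cancel]

/-- The pointwise product of two crossed homomorphisms is a crossed homomorphism.
[cite: SerreLocalFields1979, Ch. VII §3 (1-cocycles)] -/
theorem mul_crossed {f₁ f₂ : Γ → G} (hf₁ : ∀ g h, f₁ (g * h) = act g (f₁ h) * f₁ g)
    (hf₂ : ∀ g h, f₂ (g * h) = act g (f₂ h) * f₂ g) (g h : Γ) :
    f₁ (g * h) * f₂ (g * h) = act g (f₁ h * f₂ h) * (f₁ g * f₂ g) := by
  rw [hf₁, hf₂, map_mul, mul_mul_mul_comm]

/-- Twisting a crossed homomorphism by the coboundary of `c⁻¹` gives a crossed homomorphism.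
[cite: SerreLocalFields1979, Ch. VII §3 (1-cocycles)] -/
theorem twist_crossed (hmul : ∀ g h x, act (g * h) x = act g (act h x)) {f : Γ → G}
    (hf : ∀ g h, f (g * h) = act g (f h) * f g) (c : G) (g h : Γ) :
    f (g * h) * (act (g * h) c⁻¹ / c⁻¹) =
      act g (f h * (act h c⁻¹ / c⁻¹)) * (f g * (act g c⁻¹ / c⁻¹)) :=
  mul_crossed act (f₂ := fun g => act g c⁻¹ / c⁻¹) hf (fun g h => coboundary_crossed act hmul c⁻¹ g h) g h

omit [Group Γ] in
/-- Where `f` agrees with the coboundary of `c`, the twist by `c⁻¹` is trivial.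
[cite: SerreLocalFields1979, Ch. VII §3 (1-cocycles)] -/
theorem twist_eq_one_of_eq {f : Γ → G} {c : G} {g : Γ} (h : act g c / c = f g) :
    f g * (act g c⁻¹ / c⁻¹) = 1 := by
  rw [← h, map_inv, inv_div_inv, div_mul_div_cancel, div_self']

omit [Group Γ] in
/-- Untwisting: if the twist of `f` by `c⁻¹` is the coboundary of `d`, then `f` is the coboundary of
`d c`. [cite: SerreLocalFields1979, Ch. VII §3 (1-cocycles)] -/
theorem coboundary_mul_eq_of_twist_eq {f : Γ → G} {c d : G} {g : Γ}
    (h : f g * (act g c⁻¹ / c⁻¹) = act g d / d) : act g (d * c) / (d * c) = f g := by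
  rw [map_inv, inv_div_inv] at h
  rw [map_mul, mul_div_mul_comm, ← h, mul_assoc, div_mul_div_cancel, div_self', mul_one]

/-- A crossed homomorphism that is trivial at `n` satisfies `f (g n) = f g`.
[cite: SerreLocalFields1979, Ch. VII §6 (proof of Prop. 4)] -/
theorem apply_mul_eq_of_apply_eq_one {f : Γ → G} (hf : ∀ g h, f (g * h) = act g (f h) * f g)
    {n : Γ} (hn : f n = 1) (g : Γ) : f (g * n) = f g := by
  rw [hf, hn, map_one, one_mul]

/-- A crossed homomorphism that is trivial at `n` satisfies `f (n g) = n • f g`.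
[cite: SerreLocalFields1979, Ch. VII §6 (proof of Prop. 4)] -/
theorem apply_mul_eq_of_apply_eq_one_left {f : Γ → G} (hf : ∀ g h, f (g * h) = act g (f h) * f g)
    {n : Γ} (hn : f n = 1) (g : Γ) : f (n * g) = act n (f g) := by
  rw [hf, hn, mul_one]

/-- Powers: `f (σ^i) = ∏_{j<i} σ^j • f σ` for a crossed homomorphism (Neukirch I (6.1):
`x(σᵏ) = Σ_{i<k} σⁱ x(σ)`). [cite: Neukirch2013, Part I §6 Thm. (6.1) (proof)] -/
theorem apply_pow_eq_prod (hone : ∀ x, act 1 x = x) {f : Γ → G}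
    (hf : ∀ g h, f (g * h) = act g (f h) * f g) (σ : Γ) (i : ℕ) :
    f (σ ^ i) = ∏ j ∈ range i, act (σ ^ j) (f σ) := by
  induction i with
  | zero => rw [pow_zero, map_one_of_crossed act hone hf, range_zero, prod_empty]
  | succ i ih => rw [pow_succ, hf, ih, prod_range_succ_comm]

/-- Telescoping of a coboundary along powers: `∏_{j<i} σ^j • (σ • c / c) = σ^i • c / c`.
[cite: Neukirch2013, Part I §6 Thm. (6.1) (proof)] -/
theorem prod_range_pow_coboundary (hmul : ∀ g h x, act (g * h) x = act g (act h x))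
    (hone : ∀ x, act 1 x = x) (σ : Γ) (c : G) (i : ℕ) :
    ∏ j ∈ range i, act (σ ^ j) (act σ c / c) = act (σ ^ i) c / c := by
  induction i with
  | zero => rw [range_zero, prod_empty, pow_zero, hone, div_self']
  | succ i ih => rw [prod_range_succ_comm, ih, map_div, ← hmul, ← pow_succ, div_mul_div_cancel]

end Basic

/-! ## §2. Finite cyclic groups: `Ĥ⁻¹ = 0 ⟹ H¹ = 0` -/

section Cyclic

variable {Γ G : Type*} [Group Γ] [Fintype Γ] [CommGroup G] (act : Γ → G →* G)

/-- **`Ĥ⁻¹(Γ, G) = 0 ⟹ H¹(Γ, G) = 0` for a finite cyclic group `Γ = ⟨σ⟩`, element form** (the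
injectivity of `x ↦ x(σ)`, `H¹ ≅ _N A/I_G A`, Neukirch I (6.1); Serre VIII §4): if every `c` with
`∏_{g ∈ Γ} g • c = 1` is `σ • d / d` for some `d`, then every crossed homomorphism `f : Γ → G` is a
coboundary.  Indeed `∏_g g • f σ = ∏_{j<n} σ^j • f σ = f (σ^n) = f 1 = 1`, so `f σ = σ • d / d`, and then
`f (σ^i) = ∏_{j<i} σ^j • (σ • d / d) = σ^i • d / d`. [cite: Neukirch2013, Part I §6 Thm. (6.1)] -/
theorem exists_coboundary_of_isCyclic_of_normKer (hmul : ∀ g h x, act (g * h) x = act g (act h x))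
    (hone : ∀ x, act 1 x = x) {σ : Γ} (hσ : ∀ τ : Γ, τ ∈ Subgroup.zpowers σ)
    (hH : ∀ c : G, ∏ g : Γ, act g c = 1 → ∃ d : G, act σ d / d = c)
    {f : Γ → G} (hf : ∀ g h, f (g * h) = act g (f h) * f g) :
    ∃ c : G, ∀ g, act g c / c = f g := by
  classical
  have hprod : ∏ g : Γ, act g (f σ) = 1 := by
    have h := apply_pow_eq_prod act hone hf σ (Nat.card Γ)
    rw [pow_card_eq_one', map_one_of_crossed act hone hf,
      Literature.NumberTheory.GaloisRepresentations.CyclicNormIndex.prod_range_card_pow_eq_prod hσ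
        (fun g => act g (f σ))] at h
    exact h.symm
  obtain ⟨d, hd⟩ := hH _ hprod
  refine ⟨d, fun g => ?_⟩
  obtain ⟨i, rfl⟩ : ∃ i : ℕ, σ ^ i = g := by
    have := hσ g
    rwa [← mem_powers_iff_mem_zpowers, Submonoid.mem_powers_iff] at this
  rw [apply_pow_eq_prod act hone hf σ i, ← hd, prod_range_pow_coboundary act hmul hone]

end Cyclic

/-! ## §3. Inflation–restriction as a vanishing criterion -/

section InfRes

variable {N Γ Q G G' : Type*} [Group N] [Group Γ] [Group Q] [CommGroup G] [CommGroup G']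
  (act : Γ → G →* G) (act' : Q → G' →* G') (r : N →* Γ) (q : Γ →* Q) (ι : G' →* G)

/-- **Inflation–restriction in degree one as a vanishing criterion, element form** (Serre VII §6
Prop. 4: `0 → H¹(Γ/N, G^N) → H¹(Γ, G) → H¹(N, G)` is exact, so `H¹(N, G) = 0` and `H¹(Γ/N, G^N) = 0`
give `H¹(Γ, G) = 0`).  The quotient is presented abstractly by `r : N →* Γ`, `q : Γ →* Q` (`q` onto,
`q ∘ r = 1`, `ker q ⊆ r(N)`), and the fixed module `G^N` by an injective `ι : G' →* G`, equivariant for a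
`Q`-action `act'` on `G'` (`g • ι a = ι (q g • a)`), with `G^{r(N)} ⊆ ι(G')`.  Proof as printed:
untwist `f` by a coboundary so that `f|_N = 1`; then `f` is constant on `N`-cosets with `N`-fixed values,
i.e. `f = ι ∘ φ ∘ q` for a crossed homomorphism `φ : Q → G'`, which is a coboundary.
[cite: SerreLocalFields1979, Ch. VII §6 Prop. 4] -/
theorem exists_coboundary_of_inflation_restriction
    (hmul : ∀ g h x, act (g * h) x = act g (act h x))
    (hq : Function.Surjective q) (hqr : ∀ n, q (r n) = 1) (hker : ∀ g, q g = 1 → ∃ n, r n = g)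
    (hι : Function.Injective ι) (hcompat : ∀ g a, act g (ι a) = ι (act' (q g) a))
    (hdesc : ∀ c : G, (∀ n, act (r n) c = c) → ∃ a, ι a = c)
    (hN : ∀ f : N → G, (∀ n m, f (n * m) = act (r n) (f m) * f n) → ∃ c : G, ∀ n, act (r n) c / c = f n)
    (hQ : ∀ f : Q → G', (∀ x y, f (x * y) = act' x (f y) * f x) → ∃ c : G', ∀ x, act' x c / c = f x)
    {f : Γ → G} (hf : ∀ g h, f (g * h) = act g (f h) * f g) :
    ∃ c : G, ∀ g, act g c / c = f g := by
  classical
  -- Step 1: the restriction of `f` to `N` is the coboundary of some `c₀`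
  obtain ⟨c₀, hc₀⟩ := hN (fun n => f (r n)) fun n m => by simp only [map_mul, hf]
  -- Step 2: twist `f` by `c₀⁻¹`, so that it vanishes on `r(N)`
  set f' : Γ → G := fun g => f g * (act g c₀⁻¹ / c₀⁻¹) with hf'def
  have hf' : ∀ g h, f' (g * h) = act g (f' h) * f' g := fun g h => twist_crossed act hmul hf c₀ g h
  have hf'N : ∀ n, f' (r n) = 1 := fun n => twist_eq_one_of_eq act (hc₀ n)
  have hf'mul : ∀ g n, f' (g * r n) = f' g := fun g n => apply_mul_eq_of_apply_eq_one act hf' (hf'N n) g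
  have hf'fix : ∀ g n, act (r n) (f' g) = f' g := fun g n => by
    -- `r n * g = g * r n'` for some `n'`, as `q (g⁻¹ (r n) g) = 1`
    obtain ⟨n', hn'⟩ := hker (g⁻¹ * r n * g) (by rw [map_mul, map_mul, hqr, mul_one, map_inv, inv_mul_cancel])
    have h2 : r n * g = g * r n' := by rw [hn', ← mul_assoc, ← mul_assoc, mul_inv_cancel, one_mul]
    rw [← apply_mul_eq_of_apply_eq_one_left act hf' (hf'N n) g, h2, hf'mul]
  -- Step 3: the values of `f'` descend along `ι`, to a function `φ` constant on `N`-cosets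
  choose φ hφ using fun g => hdesc (f' g) (hf'fix g)
  have hφmul : ∀ g n, φ (g * r n) = φ g := fun g n => hι (by rw [hφ, hφ, hf'mul])
  -- Step 4: `φ` factors through `q` as `ψ`
  set ψ : Q → G' := fun x => φ (Function.surjInv hq x) with hψdef
  have hψ : ∀ g, ψ (q g) = φ g := fun g => by
    obtain ⟨n, hn⟩ := hker (g⁻¹ * Function.surjInv hq (q g))
      (by rw [map_mul, map_inv, Function.surjInv_eq hq, inv_mul_cancel])
    have : Function.surjInv hq (q g) = g * r n := by rw [hn, mul_inv_cancel_left]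
    rw [hψdef]
    simp only [this, hφmul]
  -- Step 5: `ψ` is a crossed homomorphism for `act'`
  have hψcross : ∀ x y, ψ (x * y) = act' x (ψ y) * ψ x := fun x y => by
    obtain ⟨g₁, rfl⟩ := hq x
    obtain ⟨g₂, rfl⟩ := hq y
    rw [← map_mul, hψ, hψ, hψ]
    apply hι
    rw [hφ, map_mul ι, ← hcompat, hφ, hφ]
    exact hf' g₁ g₂
  -- Step 6: so `ψ` is a coboundary, and then so is `f`
  obtain ⟨w, hw⟩ := hQ ψ hψcross
  refine ⟨ι w * c₀, fun g => coboundary_mul_eq_of_twist_eq act ?_⟩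
  change f' g = _
  rw [← hφ g, ← hψ g, ← hw (q g), map_div, ← hcompat]

end InfRes

end Literature.Algebra.Homology.CrossedHomElem
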